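import Literature.Algebra.Homology.DiscreteRepCategory
import Literature.NumberTheory.GaloisRepresentations.GaloisCohomology
import HarnessLib

/-!
# Objects of the category `C_Γ` of discrete representations ARE the continuous representations on
# discrete modules (Serre GC I §2.1), in particular the tree's `DiscreteGaloisModule`s

Topic `Algebra/Homology`; namespace `Literature.Algebra.Homology.DiscreteRep` (sequel of the tree's
`DiscreteRepCategory`: `DiscreteRepCat k Γ`, the abelian full subcategory of `Rep k Γ` on the
representations with open stabilisers).  Definitions with bodies (the two conversions and the Galois
specialisation) and theorems; NO named fact, no `sorry`, no instance.  Bridges `DiscreteRepCat` to the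
tree's `Literature.NumberTheory.GaloisRepresentations.ContinuousRep` (a representation with jointly
continuous action map) and `DiscreteGaloisModule K M` (= a continuous representation of
`Γ_K = Field.absoluteGaloisGroup K` on a discrete abelian group, whose continuous cohomology is the
tree's `galoisCohomology`): for the DISCRETE topology on the module the two notions coincide (tree:
`ContinuousRep.isOpen_setOf_apply_eq`, `ContinuousRep.ofStabilizerMemNhdsOne`).  Written for Route A /
step G5′-ii of the Poitou–Tate programme of crux `stmt-BirchSwinnertonDyer-19295` (cell
`bsd-schneider-ideate`, seat door-c4 gen 12): `Ext` in `C_{Γ_K}` is to be compared with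
`galoisCohomology`, so the objects must be identified first.

Source.  J.-P. Serre, *Galois Cohomology* (1997), I §2.1: for a profinite `G` acting on a discrete
`A`, continuity of `G × A → A` ⟺ every stabiliser is open ⟺ `A = ⋃ A^U`; D. Harari, *Galois
Cohomology and Class Field Theory* (2020), §4.2 (same).

## What is formalised (`k` a topological commutative ring, `Γ` a topological group, `V` a DISCRETE
## topological `k`-module; all in one universe)

* `isDiscrete_of_continuousRep` / **`ofContinuousRep ρ : DiscreteRepCat k Γ`** for
  `ρ : ContinuousRep Γ k V` (stabilisers of a continuous action on a discrete module are open);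
* **`toContinuousRep ρ h : ContinuousRep Γ k V`** for `ρ : Representation k Γ V` with
  `IsDiscrete (Rep.of ρ)` (`Γ` with continuous multiplication), `toContinuousRep_apply`,
  `toContinuousRep_ofContinuousRep`; `equivOfDiscreteTopology : Rep k Γ ≌ DiscreteRepCat k Γ` for
  `Γ` discrete (finite layers);
* the Galois case (universe `0`, `k = ℤ`): **`ofDiscreteGaloisModule ρ : DiscreteRepCat ℤ Γ_K`** for
  `ρ : DiscreteGaloisModule K M`, and `obj_ofDiscreteGaloisModule` (its underlying `Rep` is
  `Rep.of ρ.toRepresentation`).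

## References
* J.-P. Serre, *Galois Cohomology*, Springer (1997), I §2.1. [SerreGaloisCohomology1997]
* D. Harari, *Galois Cohomology and Class Field Theory* (2020), §4.2. [Harari2020]
-/

noncomputable section

universe u

namespace Literature.Algebra.Homology

namespace DiscreteRep

open CategoryTheory Literature.NumberTheory.GaloisRepresentations

variable {k Γ : Type u} [CommRing k] [TopologicalSpace k] [Group Γ] [TopologicalSpace Γ]
  {V : Type u} [AddCommGroup V] [Module k V] [TopologicalSpace V] [DiscreteTopology V]

/-- **A continuous representation on a DISCRETE module has open stabilisers.**
[cite: SerreGaloisCohomology1997, I §2.1] -/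
theorem isDiscrete_of_continuousRep (ρ : ContinuousRep Γ k V) :
    IsDiscrete (Rep.of ρ.toRepresentation) := fun x => ρ.isOpen_setOf_apply_eq x

/-- **A continuous representation on a discrete module, as an object of `C_Γ`.**
[cite: SerreGaloisCohomology1997, I §2.1] -/
abbrev ofContinuousRep (ρ : ContinuousRep Γ k V) : DiscreteRepCat k Γ :=
  ⟨Rep.of ρ.toRepresentation, isDiscrete_of_continuousRep ρ⟩

/-- **Conversely, a representation with open stabilisers on a discrete module is (jointly)
continuous** (the tree's `ContinuousRep.ofStabilizerMemNhdsOne`).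
[cite: SerreGaloisCohomology1997, I §2.1] -/
def toContinuousRep [ContinuousMul Γ] (ρ : Representation k Γ V) (h : IsDiscrete (Rep.of ρ)) :
    ContinuousRep Γ k V :=
  ContinuousRep.ofStabilizerMemNhdsOne ρ fun m => (h m).mem_nhds (by simp)

/-- Unfolding `toContinuousRep`. [cite: SerreGaloisCohomology1997, I §2.1] -/
@[simp]
theorem toContinuousRep_apply [ContinuousMul Γ] (ρ : Representation k Γ V)
    (h : IsDiscrete (Rep.of ρ)) (g : Γ) : toContinuousRep ρ h g = ρ g := rfl

/-- Round trip: the continuous representation recovered from `ofContinuousRep ρ` is `ρ`.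
[cite: SerreGaloisCohomology1997, I §2.1] -/
theorem toContinuousRep_ofContinuousRep [ContinuousMul Γ] (ρ : ContinuousRep Γ k V) :
    toContinuousRep ρ.toRepresentation (isDiscrete_of_continuousRep ρ) = ρ :=
  ContinuousRep.ext fun _ => rfl

/-! ## Discrete groups (finite Galois layers): `Rep k Γ ≌ C_Γ` -/

omit [TopologicalSpace k] in
variable (k Γ) in
/-- **For a DISCRETE group every representation is discrete: `Rep k Γ ≌ C_Γ`** (so at a finite
Galois layer `Gal(E/F)` the class modules and Tate–Nakayama isomorphisms of the tree live in `C_Γ`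
verbatim). [cite: Harari2020, §4.2] -/
def equivOfDiscreteTopology [DiscreteTopology Γ] : Rep.{u} k Γ ≌ DiscreteRepCat k Γ :=
  CategoryTheory.Equivalence.mk
    ((isDiscrete k Γ).lift (𝟭 _) fun A => isDiscrete_of_discreteTopology A) (ι k Γ)
    (Iso.refl _) (NatIso.ofComponents (fun _ => Iso.refl _) (fun _ => rfl))

end DiscreteRep

/-! ## The Galois case: `DiscreteGaloisModule K M` ↦ object of `C_{Γ_K}` -/

namespace DiscreteRep

open CategoryTheory Literature.NumberTheory.GaloisRepresentations Field

variable {K : Type} [Field K] {M : Type} [AddCommGroup M] [TopologicalSpace M] [DiscreteTopology M]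

/-- **A discrete Galois module over `K` (the tree's `DiscreteGaloisModule K M`: a continuous
representation of `Γ_K` on the discrete group `M`) as an object of the abelian category
`C_{Γ_K} = DiscreteRepCat ℤ Γ_K`.** [cite: SerreGaloisCohomology1997, I §2.1][cite: Harari2020, §4.2] -/
abbrev ofDiscreteGaloisModule (ρ : DiscreteGaloisModule K M) :
    DiscreteRepCat ℤ (absoluteGaloisGroup K) :=
  ofContinuousRep ρ

/-- Its underlying object of `Rep ℤ Γ_K` is `Rep.of ρ.toRepresentation`. [cite: Harari2020, §4.2] -/
theorem obj_ofDiscreteGaloisModule (ρ : DiscreteGaloisModule K M) :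
    (ofDiscreteGaloisModule ρ).obj = Rep.of ρ.toRepresentation := rfl

/-- Conversely an object of `C_{Γ_K}` whose carrier is given the discrete topology is a discrete
Galois module (the tree's `DiscreteGaloisModule.ofIsOpenStabilizer`). [cite: SerreGaloisCohomology1997, I §2.1] -/
def toDiscreteGaloisModule (ρ : Representation ℤ (absoluteGaloisGroup K) M)
    (h : IsDiscrete (Rep.of ρ)) : DiscreteGaloisModule K M :=
  DiscreteGaloisModule.ofIsOpenStabilizer ρ h

/-- Unfolding `toDiscreteGaloisModule`. [cite: SerreGaloisCohomology1997, I §2.1] -/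
@[simp]
theorem toDiscreteGaloisModule_apply (ρ : Representation ℤ (absoluteGaloisGroup K) M)
    (h : IsDiscrete (Rep.of ρ)) (σ : absoluteGaloisGroup K) : toDiscreteGaloisModule ρ h σ = ρ σ :=
  rfl

end DiscreteRep

end Literature.Algebra.Homology
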